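import Mathlib
import Literature.Probability.LatticeModels.ThermodynamicLimit
import Literature.MathematicalPhysics.QuantumLattice.LatticeScalarField

/-!
# `UniversalDetector.HankelTightGlue` (item stmt-QuantumFields-24002) — the lattice-path combinatorics

Helper file (definition-free, imports only the `box`/`siteToE` vocabulary) for the glue of LINE
g10-1 «Hankel tightness» (planner ym-idea-8) on route UniversalDetector (YangMills),
`SchemeEdgeLaws → HankelCeiling → HankelLongitudinal → PlaneTightScheme`; the glue itself is
`Summit.QuantumFields.YangMills.Theorems.hankelTightGlue_proof` in
`UniversalDetectorHankelTightGlue.lean`. For an abstract kernel `K β L z` (= `ker6 β L p q z`),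
boundedness off the `η/2`-ball, the transverse modulus `ω_T` inside slabs and the longitudinal
Lipschitz modulus outside half-slabs give TIGHT6's boundedness-plus-modulus clause at `η`
(`tight_of_bound_long_trans`), by pure lattice-path combinatorics: with
`δ₀ = min(η/2, τ/2)` (`τ` the slab width of TRANS at `η/2`) put

  `ω(δ) = 4 (Λ⁺ δ + ω_T⁺(δ))` for `δ ≤ δ₀`,   `ω(δ) = 2C` otherwise

(`Λ⁺ = max Λ 0`, `ω_T⁺ = max ω_T 0`, `Λ` the longitudinal constant at `(η/2, τ/2)`, `C` the bound
at `η/2`). For `‖a z - a z'‖ ≤ δ₀` walk from `z` to `z'` one coordinate at a time: every point of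
the four axis legs is coordinatewise between `z` and `z'`, hence in the box and within `δ₀ ≤ η/2`
of `a z`, so of norm `≥ η/2`; a leg has `a`-length `≤ δ₀ ≤ τ/2`, so it lies either inside the slab
`|a x_k| ≤ τ` (TRANS, monotone `ω_T`) or inside `|a x_k| ≥ τ/2` (longitudinal); far pairs are
bounded by `2C`.

Glue bookkeeping only: no crux, rung or summit is proved; the Yang–Mills mass gap is NOT proved
by this.
-/

noncomputable section

open Filter Topology
open Literature.Probability.LatticeModels (box mem_box)
open Literature.MathematicalPhysics.QuantumLattice (siteToE siteToE_apply)

namespace Summit.QuantumFields.YangMills.Theorems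

namespace UniversalDetectorHankelTight

/-! ### Euclidean-norm bookkeeping on `a • siteToE z` -/

/-- Coordinates of `a • siteToE z`. -/
theorem smul_siteToE_apply (a : ℝ) (z : Fin 4 → ℤ) (i : Fin 4) :
    (a • siteToE z) i = a * (z i : ℝ) := by
  simp [siteToE_apply]

/-- One coordinate is bounded by the Euclidean norm: `|a (z i - z' i)| ≤ ‖a z - a z'‖`. -/
theorem abs_coord_sub_le_norm (a : ℝ) (z z' : Fin 4 → ℤ) (i : Fin 4) :
    |a * ((z i : ℝ) - z' i)| ≤ ‖a • siteToE z - a • siteToE z'‖ := by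
  have h := PiLp.norm_apply_le (a • siteToE z - a • siteToE z') i
  rw [Real.norm_eq_abs] at h
  convert h using 2
  simp [siteToE_apply]
  ring

/-- Coordinatewise domination gives norm domination: if every coordinate of `w - z` is, in
absolute value, at most the corresponding coordinate of `z' - z`, then `‖a w - a z‖ ≤ ‖a z' - a z‖`. -/
theorem norm_sub_le_of_coord {a : ℝ} {w z z' : Fin 4 → ℤ}
    (h : ∀ i, |(w i : ℝ) - z i| ≤ |(z' i : ℝ) - z i|) :
    ‖a • siteToE w - a • siteToE z‖ ≤ ‖a • siteToE z' - a • siteToE z‖ := by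
  have h1 : ‖a • siteToE w - a • siteToE z‖ ^ 2 ≤ ‖a • siteToE z' - a • siteToE z‖ ^ 2 := by
    rw [EuclideanSpace.real_norm_sq_eq, EuclideanSpace.real_norm_sq_eq]
    refine Finset.sum_le_sum fun i _ => ?_
    have hw : (a • siteToE w - a • siteToE z) i = a * ((w i : ℝ) - z i) := by
      simp [siteToE_apply]; ring
    have hz : (a • siteToE z' - a • siteToE z) i = a * ((z' i : ℝ) - z i) := by
      simp [siteToE_apply]; ring
    rw [hw, hz, mul_pow, mul_pow]
    gcongr _ * ?_
    exact sq_le_sq.mpr (h i)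
  exact (pow_le_pow_iff_left₀ (norm_nonneg _) (norm_nonneg _) two_ne_zero).mp h1

/-- If every coordinate of `w` lies between the corresponding coordinates of `z` and `z'`, then
`w` is in the box whenever `z, z'` are, and `‖a w - a z‖ ≤ ‖a z' - a z‖`. -/
theorem between_props {a : ℝ} {L : ℕ} {w z z' : Fin 4 → ℤ}
    (hw : ∀ i, (z i ≤ w i ∧ w i ≤ z' i) ∨ (z' i ≤ w i ∧ w i ≤ z i))
    (hz : z ∈ box 4 L) (hz' : z' ∈ box 4 L) :
    w ∈ box 4 L ∧ ‖a • siteToE w - a • siteToE z‖ ≤ ‖a • siteToE z' - a • siteToE z‖ := by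
  rw [mem_box] at hz hz' ⊢
  refine ⟨fun i => ?_, norm_sub_le_of_coord fun i => ?_⟩
  · rcases hw i with h | h <;> constructor <;> linarith [hz i, hz' i, h.1, h.2]
  · rcases hw i with h | h
    · have h1 : (z i : ℝ) ≤ w i := by exact_mod_cast h.1
      have h2 : (w i : ℝ) ≤ z' i := by exact_mod_cast h.2
      rw [abs_of_nonneg (by linarith), abs_of_nonneg (by linarith)]; linarith
    · have h1 : (z' i : ℝ) ≤ w i := by exact_mod_cast h.1
      have h2 : (w i : ℝ) ≤ z i := by exact_mod_cast h.2
      rw [abs_of_nonpos (by linarith), abs_of_nonpos (by linarith)]; linarith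

/-! ### One axis leg -/

/-- **One axis leg.** Along the axis `k` from `w` to `w + c e_k` (all intermediate points in the box
and of norm `≥ η`), with `a|c| ≤ δ ≤ τ/2`: the leg lies either inside the slab `|a x_k| ≤ τ`, where
the transverse modulus `ω_T` applies, or inside `|a x_k| ≥ τ/2`, where the longitudinal Lipschitz
bound applies; either way `|K(w) - K(w + c e_k)| ≤ Λ δ + ω_T(δ)`. -/
theorem leg_bound (a : ℝ → ℝ) (K : ℝ → ℕ → (Fin 4 → ℤ) → ℝ) {η τ Λ δ : ℝ} {ωT : ℝ → ℝ}
    (hΛ : 0 ≤ Λ) (hωmono : Monotone ωT) (hω0 : ∀ x, 0 ≤ ωT x)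
    {β : ℝ} {L : ℕ} (haβ : 0 < a β)
    (hT : ∀ (k : Fin 4) (z : Fin 4 → ℤ) (n : ℕ), (∀ j : ℕ, j ≤ n →
        z + Pi.single k (j : ℤ) ∈ box 4 L ∧ η ≤ ‖a β • siteToE (z + Pi.single k (j : ℤ))‖ ∧
          |a β * ((z k : ℝ) + (j : ℝ))| ≤ τ) →
      |K β L z - K β L (z + Pi.single k (n : ℤ))| ≤ ωT (a β * n))
    (hLg : ∀ (k : Fin 4) (z : Fin 4 → ℤ) (n : ℕ), (∀ j : ℕ, j ≤ n →
        z + Pi.single k (j : ℤ) ∈ box 4 L ∧ η ≤ ‖a β • siteToE (z + Pi.single k (j : ℤ))‖ ∧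
          τ / 2 ≤ |a β * ((z k : ℝ) + (j : ℝ))|) →
      |K β L z - K β L (z + Pi.single k (n : ℤ))| ≤ Λ * (a β * n))
    (hδτ : δ ≤ τ / 2) (k : Fin 4) (w : Fin 4 → ℤ) (c : ℤ)
    (hseg : ∀ j : ℤ, min 0 c ≤ j → j ≤ max 0 c →
      w + Pi.single k j ∈ box 4 L ∧ η ≤ ‖a β • siteToE (w + Pi.single k j)‖)
    (hc : a β * |(c : ℝ)| ≤ δ) :
    |K β L w - K β L (w + Pi.single k c)| ≤ Λ * δ + ωT δ := by
  have hδ0 : 0 ≤ δ := le_trans (by positivity) hc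
  -- forward version along `n : ℕ` steps
  have key : ∀ (v : Fin 4 → ℤ) (n : ℕ), (∀ j : ℕ, j ≤ n →
      v + Pi.single k (j : ℤ) ∈ box 4 L ∧ η ≤ ‖a β • siteToE (v + Pi.single k (j : ℤ))‖) →
      a β * n ≤ δ → |K β L v - K β L (v + Pi.single k (n : ℤ))| ≤ Λ * δ + ωT δ := by
    intro v n hv hn
    by_cases hslab : ∀ j : ℕ, j ≤ n → |a β * ((v k : ℝ) + (j : ℝ))| ≤ τ
    · have h1 := hT k v n fun j hj => ⟨(hv j hj).1, (hv j hj).2, hslab j hj⟩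
      calc |K β L v - K β L (v + Pi.single k (n : ℤ))| ≤ ωT (a β * n) := h1
        _ ≤ ωT δ := hωmono hn
        _ ≤ Λ * δ + ωT δ := by nlinarith
    · push Not at hslab
      obtain ⟨j₀, hj₀, hτj₀⟩ := hslab
      have hfar : ∀ j : ℕ, j ≤ n → τ / 2 ≤ |a β * ((v k : ℝ) + (j : ℝ))| := by
        intro j hj
        have hdiff : |a β * ((v k : ℝ) + (j₀ : ℝ)) - a β * ((v k : ℝ) + (j : ℝ))| ≤ δ := by
          rw [← mul_sub, abs_mul, abs_of_pos haβ]
          have : |((v k : ℝ) + (j₀ : ℝ)) - ((v k : ℝ) + (j : ℝ))| ≤ n := by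
            rw [abs_le]
            have hj' : (j : ℝ) ≤ n := by exact_mod_cast hj
            have hj₀' : (j₀ : ℝ) ≤ n := by exact_mod_cast hj₀
            have hjn : (0 : ℝ) ≤ j := by positivity
            have hj₀n : (0 : ℝ) ≤ j₀ := by positivity
            constructor <;> linarith
          calc a β * |((v k : ℝ) + (j₀ : ℝ)) - ((v k : ℝ) + (j : ℝ))| ≤ a β * n := by gcongr
            _ ≤ δ := hn
        have htri := abs_sub_abs_le_abs_sub (a β * ((v k : ℝ) + (j₀ : ℝ)))
          (a β * ((v k : ℝ) + (j : ℝ)))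
        linarith
      have h1 := hLg k v n fun j hj => ⟨(hv j hj).1, (hv j hj).2, hfar j hj⟩
      calc |K β L v - K β L (v + Pi.single k (n : ℤ))| ≤ Λ * (a β * n) := h1
        _ ≤ Λ * δ := by gcongr
        _ ≤ Λ * δ + ωT δ := by linarith [hω0 δ]
  rcases le_or_gt 0 c with hc0 | hc0
  · -- forward leg
    obtain ⟨n, rfl⟩ := Int.eq_ofNat_of_zero_le hc0
    refine key w n (fun j hj => hseg j (by simp) (by
      rw [max_eq_right hc0]; exact_mod_cast hj)) ?_
    simpa [Nat.abs_cast] using hc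
  · -- backward leg: base point `w + c e_k`, `n = -c` steps forward
    obtain ⟨n, hn⟩ := Int.eq_ofNat_of_zero_le (neg_nonneg.mpr hc0.le)
    have hcn : c = -(n : ℤ) := by omega
    have hback : w = (w + Pi.single k c) + Pi.single k (n : ℤ) := by
      rw [add_assoc, ← Pi.single_add, hcn, neg_add_cancel, Pi.single_zero, add_zero]
    have hcabs : |(c : ℝ)| = n := by
      rw [hcn]; push_cast; rw [abs_neg, Nat.abs_cast]
    have h := key (w + Pi.single k c) n (fun j hj => by
      have h := hseg (c + j) (by rw [min_eq_right hc0.le]; omega)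
        (by rw [max_eq_left hc0.le]; omega)
      rwa [Pi.single_add, ← add_assoc] at h) (by rw [hcabs] at hc; exact hc)
    rw [← hback] at h
    rwa [abs_sub_comm]

/-! ### From boundedness + longitudinal + transverse moduli to TIGHT6 -/

/-- **Path combinatorics.** For a kernel `K β L z` (think `ker6 β L p q z`): boundedness off the
`η/2`-ball, the transverse modulus `ω_T` inside slabs and the longitudinal Lipschitz modulus outside
half-slabs give TIGHT6's boundedness-plus-modulus clause at `η`, with
`ω(δ) = 4(Λ⁺δ + ω_T⁺(δ))` for `δ ≤ δ₀ = min(η/2, τ/2)` and `ω(δ) = 2C` beyond. -/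
theorem tight_of_bound_long_trans (a : ℝ → ℝ) (ha : ∀ β, 0 < a β)
    (K : ℝ → ℕ → (Fin 4 → ℤ) → ℝ) {η : ℝ} (hη : 0 < η)
    (hB : ∃ C β₅ Λ₅ : ℝ, ∀ β : ℝ, β₅ ≤ β → ∀ L : ℕ, Λ₅ ≤ a β * L →
      ∀ z ∈ box 4 L, η / 2 ≤ ‖a β • siteToE z‖ → |K β L z| ≤ C)
    (hT : ∃ (τ β₅ Λ₅ : ℝ) (ω : ℝ → ℝ), 0 < τ ∧ Monotone ω ∧ Tendsto ω (𝓝[>] 0) (𝓝 0) ∧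
      ∀ β : ℝ, β₅ ≤ β → ∀ L : ℕ, Λ₅ ≤ a β * L → ∀ (k : Fin 4) (z : Fin 4 → ℤ) (n : ℕ),
        (∀ j : ℕ, j ≤ n → z + Pi.single k (j : ℤ) ∈ box 4 L ∧
          η / 2 ≤ ‖a β • siteToE (z + Pi.single k (j : ℤ))‖ ∧
            |a β * ((z k : ℝ) + (j : ℝ))| ≤ τ) →
        |K β L z - K β L (z + Pi.single k (n : ℤ))| ≤ ω (a β * n))
    (hLg : ∀ τ : ℝ, 0 < τ → ∃ Λ β₅ Λ₅ : ℝ, ∀ β : ℝ, β₅ ≤ β → ∀ L : ℕ, Λ₅ ≤ a β * L →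
      ∀ (k : Fin 4) (z : Fin 4 → ℤ) (n : ℕ),
        (∀ j : ℕ, j ≤ n → z + Pi.single k (j : ℤ) ∈ box 4 L ∧
          η / 2 ≤ ‖a β • siteToE (z + Pi.single k (j : ℤ))‖ ∧
            τ ≤ |a β * ((z k : ℝ) + (j : ℝ))|) →
        |K β L z - K β L (z + Pi.single k (n : ℤ))| ≤ Λ * (a β * n)) :
    ∃ (C β₅ Λ₅ : ℝ) (ω : ℝ → ℝ), Tendsto ω (𝓝[>] 0) (𝓝 0) ∧
      ∀ β : ℝ, β₅ ≤ β → ∀ L : ℕ, Λ₅ ≤ a β * L → ∀ z ∈ box 4 L, η ≤ ‖a β • siteToE z‖ →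
        |K β L z| ≤ C ∧ ∀ z' ∈ box 4 L, η ≤ ‖a β • siteToE z'‖ →
          |K β L z - K β L z'| ≤ ω ‖a β • siteToE z - a β • siteToE z'‖ := by
  obtain ⟨C, β₁, Λ₁, hB⟩ := hB
  obtain ⟨τ, β₂, Λ₂, ωT, hτ, hωmono, hωlim, hT⟩ := hT
  obtain ⟨Λ, β₃, Λ₃, hLg⟩ := hLg (τ / 2) (by positivity)
  set Λ' := max Λ 0 with hΛ'
  have hΛ'0 : 0 ≤ Λ' := le_max_right _ _
  set ωT' : ℝ → ℝ := fun x => max (ωT x) 0 with hωT'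
  have hωT'mono : Monotone ωT' := fun x y hxy => max_le_max (hωmono hxy) le_rfl
  have hωT'0 : ∀ x, 0 ≤ ωT' x := fun x => le_max_right _ _
  set δ₀ := min (η / 2) (τ / 2) with hδ₀
  have hδ₀pos : 0 < δ₀ := lt_min (by positivity) (by positivity)
  have hδ₀η : δ₀ ≤ η / 2 := min_le_left _ _
  have hδ₀τ : δ₀ ≤ τ / 2 := min_le_right _ _
  set ω : ℝ → ℝ := fun δ => if δ ≤ δ₀ then 4 * (Λ' * δ + ωT' δ) else 2 * C with hω
  refine ⟨C, max β₁ (max β₂ β₃), max Λ₁ (max Λ₂ Λ₃), ω, ?_, ?_⟩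
  · -- `ω → 0` at `0⁺`
    have h1 : Tendsto (fun δ : ℝ => δ) (𝓝[>] (0 : ℝ)) (𝓝 0) :=
      tendsto_nhdsWithin_of_tendsto_nhds tendsto_id
    have h2 : Tendsto ωT' (𝓝[>] (0 : ℝ)) (𝓝 0) := by
      have := hωlim.max (tendsto_const_nhds (x := (0 : ℝ)))
      simpa [hωT'] using this
    have h3 : Tendsto (fun δ => 4 * (Λ' * δ + ωT' δ)) (𝓝[>] (0 : ℝ)) (𝓝 0) := by
      have := ((h1.const_mul Λ').add h2).const_mul 4
      simpa using this
    refine h3.congr' ?_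
    have hev : ∀ᶠ δ in 𝓝[>] (0 : ℝ), δ ≤ δ₀ :=
      mem_nhdsWithin_of_mem_nhds (Filter.mem_of_superset (Iio_mem_nhds hδ₀pos)
        fun x hx => show x ≤ δ₀ from le_of_lt hx)
    filter_upwards [hev] with δ hδ
    simp only [hω, if_pos hδ]
  · intro β hβ L hL z hz hzη
    have hβ1 : β₁ ≤ β := le_trans (le_max_left _ _) hβ
    have hβ2 : β₂ ≤ β := le_trans ((le_max_left _ _).trans (le_max_right _ _)) hβ
    have hβ3 : β₃ ≤ β := le_trans ((le_max_right _ _).trans (le_max_right _ _)) hβ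
    have hL1 : Λ₁ ≤ a β * L := le_trans (le_max_left _ _) hL
    have hL2 : Λ₂ ≤ a β * L := le_trans ((le_max_left _ _).trans (le_max_right _ _)) hL
    have hL3 : Λ₃ ≤ a β * L := le_trans ((le_max_right _ _).trans (le_max_right _ _)) hL
    have haβ := ha β
    have hKz : |K β L z| ≤ C := hB β hβ1 L hL1 z hz (by linarith)
    refine ⟨hKz, fun z' hz' hz'η => ?_⟩
    set d := ‖a β • siteToE z - a β • siteToE z'‖ with hd
    by_cases hclose : d ≤ δ₀
    · -- close pairs: walk along the four coordinate axes
      have hωd : ω d = 4 * (Λ' * d + ωT' d) := by simp only [hω, if_pos hclose]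
      rw [hωd]
      have hd' : ‖a β • siteToE z' - a β • siteToE z‖ = d := by rw [hd, norm_sub_rev]
      -- the leg estimate at this `β, L`
      have hleg := fun (k : Fin 4) (w : Fin 4 → ℤ) (c : ℤ) =>
        leg_bound a K (η := η / 2) (τ := τ) (Λ := Λ') (δ := d) (ωT := ωT') hΛ'0 hωT'mono hωT'0
          (β := β) (L := L) haβ
          (fun k z n h => (hT β hβ2 L hL2 k z n h).trans (le_max_left _ _))
          (fun k z n h => (hLg β hβ3 L hL3 k z n h).trans (by
            have : (0 : ℝ) ≤ a β * n := by positivity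
            nlinarith [le_max_left Λ 0]))
          (hclose.trans hδ₀τ) k w c
      -- the intermediate points
      set mix : ℕ → (Fin 4 → ℤ) := fun i t => if (t : ℕ) < i then z' t else z t with hmix
      have hmix0 : mix 0 = z := by funext t; simp [hmix]
      have hmix4 : mix 4 = z' := by funext t; simp [hmix, t.isLt]
      have hstep : ∀ i : Fin 4, mix ((i : ℕ) + 1) = mix i + Pi.single i (z' i - z i) := by
        intro i; funext t
        by_cases hti : t = i
        · subst hti; simp [hmix]
        · have hne : (t : ℕ) ≠ (i : ℕ) := fun h => hti (Fin.ext h)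
          simp only [hmix, Pi.add_apply, Pi.single_apply, if_neg hti, add_zero]
          by_cases hlt : (t : ℕ) < (i : ℕ)
          · rw [if_pos hlt, if_pos (by omega)]
          · rw [if_neg hlt, if_neg (by omega)]
      -- each leg
      have hlegs : ∀ i : Fin 4,
          |K β L (mix i) - K β L (mix ((i : ℕ) + 1))| ≤ Λ' * d + ωT' d := by
        intro i
        rw [hstep i]
        refine hleg i (mix i) (z' i - z i) (fun j hj1 hj2 => ?_) ?_
        · -- segment points are coordinatewise between `z` and `z'`
          have hbw : ∀ t, (z t ≤ (mix i + Pi.single i j : Fin 4 → ℤ) t ∧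
              (mix i + Pi.single i j : Fin 4 → ℤ) t ≤ z' t) ∨
              (z' t ≤ (mix i + Pi.single i j : Fin 4 → ℤ) t ∧
                (mix i + Pi.single i j : Fin 4 → ℤ) t ≤ z t) := by
            intro t
            by_cases hti : t = i
            · subst hti
              simp only [hmix, Pi.add_apply, Pi.single_eq_same, lt_irrefl, if_false]
              rcases le_or_gt 0 (z' t - z t) with hc | hc
              · left; constructor <;> omega
              · right; constructor <;> omega
            · simp only [hmix, Pi.add_apply, Pi.single_apply, if_neg hti, add_zero]
              by_cases hlt : (t : ℕ) < (i : ℕ)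
              · rw [if_pos hlt]
                rcases le_total (z t) (z' t) with h | h
                · left; exact ⟨h, le_rfl⟩
                · right; exact ⟨le_rfl, h⟩
              · rw [if_neg hlt]
                rcases le_total (z t) (z' t) with h | h
                · left; exact ⟨le_rfl, h⟩
                · right; exact ⟨h, le_rfl⟩
          obtain ⟨hbox, hnorm⟩ := between_props (a := a β) hbw hz hz'
          refine ⟨hbox, ?_⟩
          rw [hd'] at hnorm
          have htri := norm_sub_norm_le (a β • siteToE z) (a β • siteToE (mix i + Pi.single i j))
          rw [norm_sub_rev] at htri
          linarith
        · have h := abs_coord_sub_le_norm (a β) z' z i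
          rw [hd'] at h
          rw [abs_mul, abs_of_pos haβ] at h
          push_cast
          exact h
      have h0 := hlegs 0
      have h1 := hlegs 1
      have h2 := hlegs 2
      have h3 := hlegs 3
      simp only [Fin.val_zero, Fin.val_one, Fin.val_two, zero_add] at h0 h1 h2 h3
      norm_num at h2 h3
      rw [hmix0] at h0
      rw [hmix4] at h3
      calc |K β L z - K β L z'|
          ≤ |K β L z - K β L (mix 1)| + |K β L (mix 1) - K β L (mix 2)| +
              |K β L (mix 2) - K β L (mix 3)| + |K β L (mix 3) - K β L z'| := by
            have t1 := abs_sub_le (K β L z) (K β L (mix 1)) (K β L z')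
            have t2 := abs_sub_le (K β L (mix 1)) (K β L (mix 2)) (K β L z')
            have t3 := abs_sub_le (K β L (mix 2)) (K β L (mix 3)) (K β L z')
            linarith
        _ ≤ 4 * (Λ' * d + ωT' d) := by linarith
    · -- far pairs
      have hωd : ω d = 2 * C := by simp only [hω, if_neg hclose]
      rw [hωd]
      have hKz' : |K β L z'| ≤ C := hB β hβ1 L hL1 z' hz' (by linarith)
      calc |K β L z - K β L z'| ≤ |K β L z| + |K β L z'| := abs_sub _ _
        _ ≤ 2 * C := by linarith

end UniversalDetectorHankelTight


end Summit.QuantumFields.YangMills.Theorems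

end
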